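import Summits.RiemannHypothesis.RiemannHypothesis.Theorems.SignConeGapRungDefs

/-!
# The graded families of the sign-cone criterion — remaining VOCABULARY
(cell `SignConeInequality`, item stmt-RiemannHypothesis-16301; lead-of-record file; rung list `Cruxes/SignConeInequality/RUNGS.md`)

`X := SignConeInequality` (route `SignCone`; banked criterion `signConeInequality_iff_riemannHypothesis`) is literally
`∀ a > 0, X_a`. The gap-count vocabulary `SingleGapAt n₀ a` / `GapRung m` is `Theorems/SignConeGapRungDefs.lean` (rung
prover b, p169332). This file adds, importably and with NO mathematics (every body is the route item's body over Mathlib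
primitives with one binder freed or one class hypothesis inserted, so that rungs close by `fun a ha h => thm a ha h`):

* `SignConeAt a`       — `X_a`, the crux at one cutoff (`SignConeInequality ↔ ∀ a > 0, SignConeAt a` is `Iff.rfl`);
* `CutoffRung T`       — L1, the CUTOFF ladder: `X_a` for all `0 < a ≤ T` (`X ↔ ∀ T, CutoffRung T`; landed rungs `T ≤ 3/2`
                          unconditionally, `T ≤ 2` on `platt_trudgian_numerical_rh`);
* `GapConfinedAt S a`  — `X_a` on the class whose far-field negativity (`|t| ≥ log 2`, `Re F(t) < 0`) lies in the node gaps
                          `[log n, log (n+1))`, `n ∈ S` — the `∀ S`-form of `GapRung` (`GapRung m ↔ ∀ S, #S ≤ m → ∀ a > 0,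
                          GapConfinedAt S a`), convenient for induction on the dirty set;
* `NearCleanAt t₀ a`, `NearCleanRung t₀` — negativity only below `t₀` (`NearCleanRung (log 2) ↔ SignConeFarField`, `Iff.rfl`);
* `FarConfinedAt s a`, `FarConfinedRung s` — negativity only at `|t| ≥ s` (crux strategist s1's far-confinement ladder).

The lattice facts (antitone / `X_∞ = X` / domination `GapRung → CutoffRung` / landed rungs) are proved in
`Theorems/SignConeGradedFamily.lean`.
-/

noncomputable section

-- `Summit.RiemannHypothesis.RiemannHypothesis.…` repeats a namespace component by design (D-0017 layout).
set_option linter.dupNamespace false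

open scoped BigOperators

namespace Summit.RiemannHypothesis.RiemannHypothesis.Theorems.SignCone

/-- `X_a`: the unit-slack prime-free sign-cone inequality at the single cutoff `a` — the body of the route item
`SignConeInequality` (stmt-RiemannHypothesis-16301) with the cutoff binder freed, verbatim. [folklore] -/
def SignConeAt (a : ℝ) : Prop :=
  ∀ (k : ℕ) (g : Fin k → ℝ → ℂ), (∀ i, (ContDiff ℝ ((⊤ : ℕ∞) : WithTop ℕ∞) (g i) ∧ HasCompactSupport (g i)) ∧ tsupport (g i) ⊆ Set.Icc (-a) a) → let F : ℝ → ℂ := fun t => ∑ i, MeasureTheory.convolution (g i) (fun u => (starRingEnd ℂ) ((g i) (-u))) (ContinuousLinearMap.mul ℂ ℂ) MeasureTheory.MeasureSpace.volume t; (∀ n : ℕ, 2 ≤ n → 0 ≤ (F (Real.log n)).re) → let M : ℂ → ℂ := fun s => ∫ u : ℝ, F u * Complex.exp ((s - 1 / 2) * u); -(F 0).re ≤ (M 0 + M 1 + ((1 / (2 * Real.pi) : ℂ) * (∫ t : ℝ, M (1 / 2 + t * Complex.I) * ((Complex.digamma (1 / 4 + t / 2 * Complex.I)).re : ℂ)) -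 F 0 * (Real.log Real.pi : ℂ))).re

/-- Rung `T` of the CUTOFF ladder L1: `X_a` for every `0 < a ≤ T`. [folklore] -/
def CutoffRung (T : ℝ) : Prop :=
  ∀ a : ℝ, 0 < a → a ≤ T → SignConeAt a

/-- `X_a` on the GAP-CONFINED class: node-nonnegative tests whose far-field negativity lies in the node gaps
`[log n, log (n + 1))`, `n ∈ S` (the dirty gaps; same half-open convention as `GapRung`). [folklore] -/
def GapConfinedAt (S : Finset ℕ) (a : ℝ) : Prop :=
  ∀ (k : ℕ) (g : Fin k → ℝ → ℂ), (∀ i, (ContDiff ℝ ((⊤ : ℕ∞) : WithTop ℕ∞) (g i) ∧ HasCompactSupport (g i)) ∧ tsupport (g i) ⊆ Set.Icc (-a) a) → let F : ℝ → ℂ := fun t => ∑ i, MeasureTheory.convolution (g i) (fun u => (starRingEnd ℂ) ((g i) (-u))) (ContinuousLinearMap.mul ℂ ℂ) MeasureTheory.MeasureSpace.volume t; (∀ n : ℕ, 2 ≤ n → 0 ≤ (F (Real.log n)).re) → (∀ t : ℝ, Real.log 2 ≤ |t| → (F t).re < 0 → ∃ n ∈ S, Real.log n ≤ |t| ∧ |t|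 < Real.log (n + 1)) → let M : ℂ → ℂ := fun s => ∫ u : ℝ, F u * Complex.exp ((s - 1 / 2) * u); -(F 0).re ≤ (M 0 + M 1 + ((1 / (2 * Real.pi) : ℂ) * (∫ t : ℝ, M (1 / 2 + t * Complex.I) * ((Complex.digamma (1 / 4 + t / 2 * Complex.I)).re : ℂ)) - F 0 * (Real.log Real.pi : ℂ))).re

/-- `X_a` on the NEAR-CLEAN class: `Re F ≥ 0` for all `|t| ≥ t₀` (negativity only below `t₀`). [folklore] -/
def NearCleanAt (t₀ a : ℝ) : Prop :=
  ∀ (k : ℕ) (g : Fin k → ℝ → ℂ), (∀ i, (ContDiff ℝ ((⊤ : ℕ∞) : WithTop ℕ∞) (g i) ∧ HasCompactSupport (g i)) ∧ tsupport (g i) ⊆ Set.Icc (-a) a) → let F : ℝ → ℂ := fun t => ∑ i, MeasureTheory.convolution (g i) (fun u => (starRingEnd ℂ) ((g i) (-u))) (ContinuousLinearMap.mul ℂ ℂ) MeasureTheory.MeasureSpace.volume t; (∀ n : ℕ, 2 ≤ n → 0 ≤ (F (Real.log n)).re) → (∀ t : ℝ, t₀ ≤ |t| → 0 ≤ (F t).re)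 → let M : ℂ → ℂ := fun s => ∫ u : ℝ, F u * Complex.exp ((s - 1 / 2) * u); -(F 0).re ≤ (M 0 + M 1 + ((1 / (2 * Real.pi) : ℂ) * (∫ t : ℝ, M (1 / 2 + t * Complex.I) * ((Complex.digamma (1 / 4 + t / 2 * Complex.I)).re : ℂ)) - F 0 * (Real.log Real.pi : ℂ))).re

/-- Rung `t₀` of the NEAR-CLEAN ladder (every cutoff); `t₀ = log 2` is `SignConeFarField` verbatim. [folklore] -/
def NearCleanRung (t₀ : ℝ) : Prop :=
  ∀ a : ℝ, 0 < a → NearCleanAt t₀ a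

/-- `X_a` on the FAR-CONFINED class: `Re F ≥ 0` on `log 2 ≤ |t| < s` (far-field negativity, if any, only at
`|t| ≥ s`; crux strategist s1). [folklore] -/
def FarConfinedAt (s a : ℝ) : Prop :=
  ∀ (k : ℕ) (g : Fin k → ℝ → ℂ), (∀ i, (ContDiff ℝ ((⊤ : ℕ∞) : WithTop ℕ∞) (g i) ∧ HasCompactSupport (g i)) ∧ tsupport (g i) ⊆ Set.Icc (-a) a) → let F : ℝ → ℂ := fun t => ∑ i, MeasureTheory.convolution (g i) (fun u => (starRingEnd ℂ) ((g i) (-u))) (ContinuousLinearMap.mul ℂ ℂ) MeasureTheory.MeasureSpace.volume t; (∀ n : ℕ, 2 ≤ n → 0 ≤ (F (Real.log n)).re) → (∀ t : ℝ, Real.log 2 ≤ |t| → |t| < s → 0 ≤ (F t).re) → let M : ℂ → ℂ := fun s => ∫ u : ℝ, F u * Complex.exp ((s - 1 / 2) * u); -(F 0).re ≤ (M 0 + M 1 + ((1 / (2 * Real.pi) : ℂ) * (∫ t : ℝ, M (1 / 2 + t * Complex.I) * ((Complex.digamma (1 / 4 + t / 2 * Complex.I)).re : ℂ)) - F 0 *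 (Real.log Real.pi : ℂ))).re

/-- Rung `s` of the FAR-CONFINEMENT ladder (every cutoff); `s ≤ log 2` is the crux again. [folklore] -/
def FarConfinedRung (s : ℝ) : Prop :=
  ∀ a : ℝ, 0 < a → FarConfinedAt s a

end Summit.RiemannHypothesis.RiemannHypothesis.Theorems.SignCone

end
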